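import Literature.Geometry.GeometricMeasureTheory.RectifiableImagePiece
import Literature.Geometry.GeometricMeasureTheory.PushforwardCurrent

/-!
# The image current of a bi-Lipschitz piece with integer density is a current of integration

Second brick of `f_# 𝓡_m ⊆ 𝓡_m` (Federer 4.1.30). For a measurable piece `s ⊆ P`
(`dim P = n`), a map `f : P → V` differentiable relative to `s` with injective differentials and
injective on `s`, and an INTEGER density `θ̃ : P → ℤ` with `x ↦ θ̃ x • (f' x e₁ ∧ ⋯ ∧ f' x eₙ)`
integrable on `s` (`e` an orthonormal basis of `P`), the push-forward of `[s, θ̃, e]` is the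
current of integration over `f(s)` with

* `imageDensity f s θ̃` — the transported density `θ̃ ∘ (f|_s)⁻¹` (`0` off `f(s)`),
* `imageFrame f f' s e` — the Gram–Schmidt frame of `(f' x eⱼ)` at `y = f x` (`0` off `f(s)`):

`currentOfIntegration_image_density_apply : [f(s), θ̃ ∘ f⁻¹, ξ](φ) = ∫_s θ̃ x · φ(f x)(f' x e) dx`
(area formula of `Literature/Analysis/Calculus/AreaFormulaHausdorff.lean`, Jacobian rule
`J f · φ(ξ) = φ(f' e)` of `PushforwardCurrent.lean`), `integrableOn_imageDensity_smul_frameVector`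
(finite mass `∫_{f(s)} |θ̃ ∘ f⁻¹| d𝓗ⁿ = ∫_s |θ̃| J f`), and — for `P = ℝⁿ` and `f` Lipschitz and
anti-Lipschitz on `s` — **`isRectifiableData_image_density`: `(f(s), θ̃ ∘ f⁻¹, ξ)` are admissible
rectifiable data** (`IsRectifiableData`), the frame condition `span ξ = Tan^n(𝓗ⁿ ⌞ f(s), ·)` a.e.
being `ae_approxTangentCone_image_eq_range` of `RectifiableImagePiece.lean`.

Definitions (`imageDensity`, `imageFrame`, with bodies) + theorems; no named facts.

## References

* H. Federer, *Geometric Measure Theory*, Springer 1969, 3.2.5, 3.2.19, 4.1.25, 4.1.28, 4.1.30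
  [Federer1969].
-/

noncomputable section

open scoped InnerProductSpace ENNReal NNReal Topology
open MeasureTheory MeasureTheory.Measure Set Function Filter Module InnerProductSpace TopologicalSpace
open Literature.Analysis.Calculus

namespace Literature.Geometry.GeometricMeasureTheory

-- Nested operator-norm instances on (duals of) `V [⋀^Fin n]→L[ℝ] ℝ`.
set_option maxSynthPendingDepth 2

/-! ### The transported density and frame -/

section Defs

variable {P : Type*} {V : Type*} [NormedAddCommGroup V] [InnerProductSpace ℝ V] {n : ℕ}

/-- **The transported density `θ̃ ∘ (f|_s)⁻¹`** on `V` (`0` off `f(s)`). [cite: Federer1969, 4.1.30] -/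
def imageDensity (f : P → V) (s : Set P) (θ : P → ℤ) : V → ℤ := fun y =>
  open scoped Classical in
  if h : ∃ x ∈ s, f x = y then θ h.choose else 0

/-- **The transported frame**: the Gram–Schmidt orthonormalisation of `(f' x e₁, …, f' x eₙ)` at
`y = f x`, `x ∈ s` (`0` off `f(s)`). [cite: Federer1969, 4.1.25, 4.1.28] -/
def imageFrame [NormedAddCommGroup P] [InnerProductSpace ℝ P] (f : P → V) (f' : P → P →L[ℝ] V)
    (s : Set P) (e : OrthonormalBasis (Fin n) ℝ P) : V → Fin n → V := fun y =>
  open scoped Classical in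
  if h : ∃ x ∈ s, f x = y then gramSchmidtNormed ℝ fun j => f' h.choose (e j) else 0

omit [NormedAddCommGroup V] [InnerProductSpace ℝ V] in
/-- On `f(s)`, `imageDensity` is `θ̃ ∘ f⁻¹` (for `f` injective on `s`). [folklore] -/
theorem imageDensity_apply_image {f : P → V} {s : Set P} (hf : InjOn f s) (θ : P → ℤ) {x : P}
    (hx : x ∈ s) : imageDensity f s θ (f x) = θ x := by
  classical
  have h : ∃ x' ∈ s, f x' = f x := ⟨x, hx, rfl⟩
  unfold imageDensity
  rw [dif_pos h]
  exact congrArg θ (hf h.choose_spec.1 hx h.choose_spec.2)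

omit [NormedAddCommGroup V] [InnerProductSpace ℝ V] in
/-- Off `f(s)`, `imageDensity` vanishes. [folklore] -/
theorem imageDensity_apply_of_notMem {f : P → V} {s : Set P} (θ : P → ℤ) {y : V}
    (hy : y ∉ f '' s) : imageDensity f s θ y = 0 := by
  classical
  unfold imageDensity
  rw [dif_neg]
  rintro ⟨x, hx, rfl⟩
  exact hy ⟨x, hx, rfl⟩

/-- On `f(s)`, `imageFrame` is the Gram–Schmidt frame of `(f' x eⱼ)`. [folklore] -/
theorem imageFrame_apply_image [NormedAddCommGroup P] [InnerProductSpace ℝ P] {f : P → V}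
    {f' : P → P →L[ℝ] V} {s : Set P} (hf : InjOn f s) (e : OrthonormalBasis (Fin n) ℝ P) {x : P}
    (hx : x ∈ s) : imageFrame f f' s e (f x) = gramSchmidtNormed ℝ fun j => f' x (e j) := by
  classical
  have h : ∃ x' ∈ s, f x' = f x := ⟨x, hx, rfl⟩
  unfold imageFrame
  rw [dif_pos h, hf h.choose_spec.1 hx h.choose_spec.2]

/-- Off `f(s)`, `imageFrame` vanishes. [folklore] -/
theorem imageFrame_apply_of_notMem [NormedAddCommGroup P] [InnerProductSpace ℝ P] {f : P → V}
    {f' : P → P →L[ℝ] V} {s : Set P} (e : OrthonormalBasis (Fin n) ℝ P) {y : V} (hy : y ∉ f '' s) :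
    imageFrame f f' s e y = 0 := by
  classical
  unfold imageFrame
  rw [dif_neg]
  rintro ⟨x, hx, rfl⟩
  exact hy ⟨x, hx, rfl⟩

end Defs

/-! ### Finite mass and the integral formula -/

section Formula

variable {P : Type*} [NormedAddCommGroup P] [InnerProductSpace ℝ P] [FiniteDimensional ℝ P]
  [MeasurableSpace P] [BorelSpace P]
  {V : Type*} [NormedAddCommGroup V] [InnerProductSpace ℝ V] [FiniteDimensional ℝ V]
  [MeasurableSpace V] [BorelSpace V] {n : ℕ}
  {f : P → V} {f' : P → P →L[ℝ] V} {s : Set P}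

omit [MeasurableSpace P] [BorelSpace P] [MeasurableSpace V] [BorelSpace V] [FiniteDimensional ℝ V] in
/-- The pointwise Jacobian rule for the transported data:
`J(f' x) • (θ̃ • ξ)(f x) = θ̃ x • (f' x e₁ ∧ ⋯ ∧ f' x eₙ)` on `s`. [cite: Federer1969, 3.2.1, 1.7.6] -/
theorem normDet_smul_imageDensity_smul_frameVector (hinj : ∀ x ∈ s, Injective (f' x))
    (hf : InjOn f s) (e : OrthonormalBasis (Fin n) ℝ P) (θ : P → ℤ) {x : P} (hx : x ∈ s) :
    (f' x : P →ₗ[ℝ] V).normDet •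
        ((imageDensity f s θ (f x) : ℝ) • frameVector (imageFrame f f' s e (f x))) =
      (θ x : ℝ) • frameVector fun j => f' x (e j) := by
  rw [imageDensity_apply_image hf θ hx, imageFrame_apply_image hf e hx, smul_comm,
    ← frameVector_comp_eq_normDet_smul_gramSchmidtNormed (hinj x hx) e]

/-- **Finite mass of the image data**: `y ↦ (θ̃ ∘ f⁻¹)(y) • ξ(y)` is integrable on `f(s)` for
`𝓗ⁿ` iff `x ↦ θ̃ x • (f' x e₁ ∧ ⋯ ∧ f' x eₙ)` is integrable on `s` (change of variables).
[cite: Federer1969, 3.2.5, 4.1.28] -/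
theorem integrableOn_imageDensity_smul_frameVector_iff (hs : MeasurableSet s)
    (hf' : ∀ x ∈ s, HasFDerivWithinAt f (f' x) s x) (hinj : ∀ x ∈ s, Injective (f' x))
    (hf : InjOn f s) (e : OrthonormalBasis (Fin n) ℝ P) (θ : P → ℤ) :
    IntegrableOn (fun y => (imageDensity f s θ y : ℝ) • frameVector (imageFrame f f' s e y))
        (f '' s) (μHE[n] : Measure V) ↔
      IntegrableOn (fun x => (θ x : ℝ) • frameVector fun j => f' x (e j)) s := by
  have hn := finrank_eq_of_orthonormalBasis_fin e
  have h := integrableOn_image_iff_integrableOn_normDet_smul hs hf' hinj hf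
    (fun y => (imageDensity f s θ y : ℝ) • frameVector (imageFrame f f' s e y))
  rw [hn] at h
  rw [h]
  exact integrableOn_congr_fun (fun x hx =>
    normDet_smul_imageDensity_smul_frameVector hinj hf e θ hx) hs

/-- **The image current is computed on the parameter side**:
`[f(s), θ̃ ∘ f⁻¹, ξ](φ) = ∫_s θ̃ x · φ(f x)(f' x e₁, …, f' x eₙ) dx` for every test form `φ`, when
the parameter-side density is integrable. [cite: Federer1969, 4.1.25, 4.1.30] -/
theorem currentOfIntegration_image_density_apply {Ω : Opens V} (hs : MeasurableSet s)
    (hf' : ∀ x ∈ s, HasFDerivWithinAt f (f' x) s x) (hinj : ∀ x ∈ s, Injective (f' x))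
    (hf : InjOn f s) (e : OrthonormalBasis (Fin n) ℝ P) {θ : P → ℤ}
    (hθ : IntegrableOn (fun x => (θ x : ℝ) • frameVector fun j => f' x (e j)) s)
    (φ : TestForm Ω n) :
    currentOfIntegration (f '' s) (imageDensity f s θ) (imageFrame f f' s e) φ =
      ∫ x in s, (θ x : ℝ) * φ (f x) fun j => f' x (e j) := by
  have hn := finrank_eq_of_orthonormalBasis_fin e
  have hint := (integrableOn_imageDensity_smul_frameVector_iff hs hf' hinj hf e θ).2 hθ
  have hloc : LocallyIntegrableOn
      (fun y => (imageDensity f s θ y : ℝ) • frameVector (imageFrame f f' s e y)) (Ω : Set V)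
      ((μHE[n] : Measure V).restrict (f '' s)) :=
    (hint.integrable.locallyIntegrable).locallyIntegrableOn _
  rw [currentOfIntegration_apply hloc]
  have h := integral_image_eq_integral_normDet_smul hs hf' hinj hf
    (fun y => (imageDensity f s θ y : ℝ) * φ y (imageFrame f f' s e y))
  rw [hn] at h
  rw [h]
  refine setIntegral_congr_fun hs fun x hx => ?_
  simp only [smul_eq_mul]
  rw [imageDensity_apply_image hf θ hx, imageFrame_apply_image hf e hx, mul_left_comm,
    normDet_mul_apply_gramSchmidtNormed (hinj x hx) e (φ (f x))]

end Formula

/-! ### Admissible rectifiable data (parameter space `ℝⁿ`) -/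

section Data

variable {V : Type*} [NormedAddCommGroup V] [InnerProductSpace ℝ V] [FiniteDimensional ℝ V]
  [MeasurableSpace V] [BorelSpace V] {n : ℕ}
  {f : EuclideanSpace ℝ (Fin n) → V} {f' : EuclideanSpace ℝ (Fin n) → EuclideanSpace ℝ (Fin n) →L[ℝ] V}
  {s : Set (EuclideanSpace ℝ (Fin n))}

/-- A set contained in the image of a Lipschitz map on a subset of `ℝⁿ` is countably
`n`-rectifiable (extend the map to all of `ℝⁿ`, `LipschitzOnWith.extend_finite_dimension`).
[cite: Federer1969, 3.2.14] -/
theorem isCountablyRectifiable_of_subset_image_lipschitzOnWith {L : ℝ≥0} (hlip : LipschitzOnWith L f s)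
    {W : Set V} (hW : W ⊆ f '' s) : IsCountablyRectifiable n W := by
  obtain ⟨g, hg, hgE⟩ := hlip.extend_finite_dimension
  refine ⟨fun _ => g, fun _ => ⟨_, hg⟩, ?_⟩
  have : W \ ⋃ _i : ℕ, range g = ∅ := by
    refine eq_empty_iff_forall_notMem.2 fun y hy => hy.2 ?_
    obtain ⟨x, hx, rfl⟩ := hW hy.1
    exact mem_iUnion.2 ⟨0, ⟨x, (hgE hx).symm⟩⟩
  rw [this, measure_empty]

/-- **The image of a bi-Lipschitz piece with integer density gives admissible rectifiable data**:
for `s ⊆ ℝⁿ` measurable, `f` differentiable relative to `s` with injective differentials, Lipschitz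
and anti-Lipschitz on `s`, and an integer density `θ̃` with `θ̃ • (f' e₁ ∧ ⋯ ∧ f' eₙ)` integrable on
`s`, the triple `(f(s), θ̃ ∘ f⁻¹, ξ)` (`ξ` the Gram–Schmidt frame of `f' e`) satisfies
`IsRectifiableData` on every open `Ω ⊇ f(s)`. [cite: Federer1969, 4.1.28 (4), 3.2.19, 4.1.30] -/
theorem isRectifiableData_image_density (hs : MeasurableSet s)
    (hf' : ∀ x ∈ s, HasFDerivWithinAt f (f' x) s x) (hinj : ∀ x ∈ s, Injective (f' x))
    {K : ℝ≥0} (hanti : AntilipschitzWith K (s.restrict f)) {L : ℝ≥0} (hlip : LipschitzOnWith L f s)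
    {θ : EuclideanSpace ℝ (Fin n) → ℤ}
    (hθ : IntegrableOn (fun x => (θ x : ℝ) • frameVector fun j =>
      f' x (EuclideanSpace.basisFun (Fin n) ℝ j)) s)
    {Ω : Opens V} (hΩ : f '' s ⊆ Ω) :
    IsRectifiableData Ω n (f '' s) (imageDensity f s θ)
      (imageFrame f f' s (EuclideanSpace.basisFun (Fin n) ℝ)) := by
  set e := EuclideanSpace.basisFun (Fin n) ℝ with he
  have hf : InjOn f s := fun a ha b hb h => by
    have := hanti.injective (a₁ := ⟨a, ha⟩) (a₂ := ⟨b, hb⟩) (by simpa using h)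
    exact congrArg Subtype.val this
  have hWm := measurableSet_image_of_hasFDerivWithinAt hs hf' hf
  refine ⟨hWm, hΩ, isCountablyRectifiable_of_subset_image_lipschitzOnWith hlip Subset.rfl, ?_, ?_⟩
  · have hint := (integrableOn_imageDensity_smul_frameVector_iff hs hf' hinj hf e θ).2 hθ
    exact (hint.integrable.locallyIntegrable).locallyIntegrableOn _
  · have hae := ae_approxTangentCone_image_eq_range hf' hinj hanti hlip hWm
    have hmem : ∀ᵐ y ∂((μHE[n] : Measure V).restrict (f '' s)), y ∈ f '' s := ae_restrict_mem hWm
    filter_upwards [hae, hmem] with y hy hymem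
    obtain ⟨x, hx, rfl⟩ := hymem
    rw [imageFrame_apply_image hf e hx]
    refine ⟨orthonormal_gramSchmidtNormed_comp (hinj x hx) e, ?_⟩
    rw [hy x hx rfl, span_gramSchmidtNormed_comp, LinearMap.coe_range]
    rfl

/-- The transported data define a current equal to the parameter-side integral and satisfying
`IsRectifiableData`; in particular it is a locally rectifiable current.
[cite: Federer1969, 4.1.28, 4.1.30] -/
theorem isLocallyRectifiable_currentOfIntegration_image_density (hs : MeasurableSet s)
    (hf' : ∀ x ∈ s, HasFDerivWithinAt f (f' x) s x) (hinj : ∀ x ∈ s, Injective (f' x))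
    {K : ℝ≥0} (hanti : AntilipschitzWith K (s.restrict f)) {L : ℝ≥0} (hlip : LipschitzOnWith L f s)
    {θ : EuclideanSpace ℝ (Fin n) → ℤ}
    (hθ : IntegrableOn (fun x => (θ x : ℝ) • frameVector fun j =>
      f' x (EuclideanSpace.basisFun (Fin n) ℝ j)) s)
    {Ω : Opens V} (hΩ : f '' s ⊆ Ω) :
    (currentOfIntegration (f '' s) (imageDensity f s θ)
      (imageFrame f f' s (EuclideanSpace.basisFun (Fin n) ℝ)) : Current Ω n).IsLocallyRectifiable :=
  ⟨_, _, _, isRectifiableData_image_density hs hf' hinj hanti hlip hθ hΩ, rfl⟩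

end Data

end Literature.Geometry.GeometricMeasureTheory
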